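import Summits.CriticalPhenomena.PercolationContinuityZ3.Theorems.Transplant.SectorSlabOwnCriticalPoint
import Summits.CriticalPhenomena.PercolationContinuityZ3.Theorems.Transplant.RationalHalfSlabDesign
import HarnessLib

/-!
# TWO-SIDED sector-slabs of arbitrary real apertures `𝔹 = {x ∈ S_k | −s₁x₁ ≤ x₂ ≤ s₂x₁}` (`s₁, s₂ > 0`): the station design

builds on p205010 (kernel theorem, internal audit signed; external expert review pending) — NOT used in this file.
Lane `prim-bschramm`, seat `prim-bschramm-p2` (gen 23; class C1b, METHOD = input substitution; memo `HOME/bschramm/P2-LATTICES.md` §82);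
helper file (`--supports stmt-CriticalPhenomena-4575 --as helper`).  `𝔹` is the slab cut by a CONVEX planar sector of aperture
`arctan s₁ + arctan s₂ ∈ (0°, 180°)` whose interior contains the axis direction `+e₁` — neither edge on an axis.  With an integer `m ≥ 1`,
`m s₁ ≥ 1`, `m s₂ ≥ 1`: station `Ω = (0, m(4N+4), −(4N+4))` sweeping right to `Z = 4N+4` below `T = (m+1)(4N+4)`; arms `steepSetM (4m) k σ b`
(slope `1/(4m) ≤ min(s₁, s₂)/4`) from the top face (leaning towards the axis), the right face (`+e₂`) and the left face (`−e₂`) stay in `𝔹` because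
the exit `b` does (`x₂ ≤ b₂ + s₂(x₁ − b₁) ≤ s₂x₁` etc.); no bottom face; window `M = k + (m+1)(4N+4)`; `P ≥ α_{4m}·α`; `≤ k+1` edges.
* `mem_bsec_iff`, `bsec_cyl`, `nonneg_of_mem_bsec`, `mem_bsec_of_armPos`, `mem_bsec_of_armNeg`, `bsec_station_props`, **`bsec_vertex_design`**.
Sequel `BiSectorSlabRow`: `p_c = p_c(S_k)`, `θ(p_c) = 0`, `N ≤ 1` ∀p, `θ_v ∈ C[0,1]` at every vertex, eight orientations.
[cite: AizenmanChayesChayesFrohlichRusso1983, §4 Thm 4.4, Lemma 4.2 (a), Lemma 4.3] [cite: DuminilCopinSidoraviciusTassion2016, Thm. 1 and §2] -/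

noncomputable section

namespace Summit.CriticalPhenomena.PercolationContinuityZ3.Theorems.Transplant

namespace BiSectorSlab

open MeasureTheory Literature.Probability.Percolation Literature.Probability.LatticeModels SimpleGraph HSU OrthantUniq HalfSlabUniq
  ConeSlabUniq SectorSlab RationalHalfSlab Filter
open scoped Classical Topology

variable {k m : ℕ} {N : ℕ} {s₁ s₂ : ℝ}

/-! ## §1 The two-sided sector-slab -/

/-- Membership. [folklore] -/
theorem mem_bsec_iff {x : Site 3} :
    x ∈ {x : Site 3 | x ∈ slab 3 k ∧ (-(s₁ * (x 1 : ℝ)) ≤ (x 2 : ℝ) ∧ (x 2 : ℝ) ≤ s₂ * (x 1 : ℝ))} ↔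
      (0 ≤ x 0 ∧ x 0 ≤ (k : ℤ)) ∧ (-(s₁ * (x 1 : ℝ)) ≤ (x 2 : ℝ) ∧ (x 2 : ℝ) ≤ s₂ * (x 1 : ℝ)) := Iff.rfl

/-- The domain is cylindrical. [folklore] -/
theorem bsec_cyl : ∀ x ∈ {x : Site 3 | x ∈ slab 3 k ∧ (-(s₁ * (x 1 : ℝ)) ≤ (x 2 : ℝ) ∧ (x 2 : ℝ) ≤ s₂ * (x 1 : ℝ))}, ∀ y ∈ slab 3 k,
    y 1 = x 1 → y 2 = x 2 → y ∈ {x : Site 3 | x ∈ slab 3 k ∧ (-(s₁ * (x 1 : ℝ)) ≤ (x 2 : ℝ) ∧ (x 2 : ℝ) ≤ s₂ * (x 1 : ℝ))} := by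
  intro x hx y hy h1 h2
  exact ⟨hy, by rw [h1, h2]; exact hx.2⟩

/-- The domain lies in the slab. [folklore] -/
theorem bsec_subset_slab : {x : Site 3 | x ∈ slab 3 k ∧ (-(s₁ * (x 1 : ℝ)) ≤ (x 2 : ℝ) ∧ (x 2 : ℝ) ≤ s₂ * (x 1 : ℝ))} ⊆ slab 3 k :=
  fun _ hx => hx.1

/-- In the two-sided sector `x₁ ≥ 0` (`s₁, s₂ > 0`). [folklore] -/
theorem nonneg_of_mem_bsec (hs₁ : 0 < s₁) (hs₂ : 0 < s₂) {x : Site 3}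
    (hx : x ∈ {x : Site 3 | x ∈ slab 3 k ∧ (-(s₁ * (x 1 : ℝ)) ≤ (x 2 : ℝ) ∧ (x 2 : ℝ) ≤ s₂ * (x 1 : ℝ))}) : 0 ≤ x 1 := by
  obtain ⟨-, h2, h3⟩ := hx
  by_contra h
  push Not at h
  have h' : (x 1 : ℝ) ≤ -1 := by exact_mod_cast (show x 1 ≤ -1 by omega)
  nlinarith

/-- **Arms leaning `+e₂` from an apex `b ∈ 𝔹` stay in `𝔹`** (slope `1/(4m)`, `4m·s₂ ≥ 1`, `s₁ ≥ 0`): `x₁ ≥ b₁`, `0 ≤ x₂ − b₂`, `4m(x₂ − b₂) ≤ x₁ − b₁`.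
[folklore] -/
theorem mem_bsec_of_armPos (hs₁ : 0 ≤ s₁) (hms₂ : 1 ≤ 4 * (m : ℝ) * s₂) {b x : Site 3}
    (hb : b ∈ {x : Site 3 | x ∈ slab 3 k ∧ (-(s₁ * (x 1 : ℝ)) ≤ (x 2 : ℝ) ∧ (x 2 : ℝ) ≤ s₂ * (x 1 : ℝ))}) (hx0 : x ∈ slab 3 k)
    (h1 : 0 ≤ x 2 - b 2) (h2 : 4 * (m : ℤ) * (x 2 - b 2) ≤ x 1 - b 1) :
    x ∈ {x : Site 3 | x ∈ slab 3 k ∧ (-(s₁ * (x 1 : ℝ)) ≤ (x 2 : ℝ) ∧ (x 2 : ℝ) ≤ s₂ * (x 1 : ℝ))} := by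
  obtain ⟨-, hb2, hb3⟩ := hb
  have h1r : (0 : ℝ) ≤ (x 2 : ℝ) - (b 2 : ℝ) := by exact_mod_cast h1
  have h2r : 4 * (m : ℝ) * ((x 2 : ℝ) - (b 2 : ℝ)) ≤ (x 1 : ℝ) - (b 1 : ℝ) := by exact_mod_cast h2
  have hm0 : (0 : ℝ) ≤ 4 * (m : ℝ) := by positivity
  have hd : (0 : ℝ) ≤ (x 1 : ℝ) - (b 1 : ℝ) := le_trans (mul_nonneg hm0 h1r) h2r
  refine ⟨hx0, ?_, ?_⟩
  · have : s₁ * (b 1 : ℝ) ≤ s₁ * (x 1 : ℝ) := mul_le_mul_of_nonneg_left (by linarith) hs₁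
    linarith
  · -- `x₂ − b₂ ≤ (x₁ − b₁)/(4m) ≤ s₂ (x₁ − b₁)`
    have e1 : 1 * ((x 2 : ℝ) - (b 2 : ℝ)) ≤ (4 * (m : ℝ) * s₂) * ((x 2 : ℝ) - (b 2 : ℝ)) := mul_le_mul_of_nonneg_right hms₂ h1r
    have e2 : s₂ * (4 * (m : ℝ) * ((x 2 : ℝ) - (b 2 : ℝ))) ≤ s₂ * ((x 1 : ℝ) - (b 1 : ℝ)) :=
      mul_le_mul_of_nonneg_left h2r (by nlinarith)
    nlinarith

/-- **Arms leaning `−e₂` from an apex `b ∈ 𝔹` stay in `𝔹`** (slope `1/(4m)`, `4m·s₁ ≥ 1`, `s₂ ≥ 0`): `x₁ ≥ b₁`, `0 ≤ b₂ − x₂`, `4m(b₂ − x₂) ≤ x₁ − b₁`.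
[folklore] -/
theorem mem_bsec_of_armNeg (hs₂ : 0 ≤ s₂) (hms₁ : 1 ≤ 4 * (m : ℝ) * s₁) {b x : Site 3}
    (hb : b ∈ {x : Site 3 | x ∈ slab 3 k ∧ (-(s₁ * (x 1 : ℝ)) ≤ (x 2 : ℝ) ∧ (x 2 : ℝ) ≤ s₂ * (x 1 : ℝ))}) (hx0 : x ∈ slab 3 k)
    (h1 : 0 ≤ (-1 : ℤ) * (x 2 - b 2)) (h2 : 4 * (m : ℤ) * ((-1 : ℤ) * (x 2 - b 2)) ≤ x 1 - b 1) :
    x ∈ {x : Site 3 | x ∈ slab 3 k ∧ (-(s₁ * (x 1 : ℝ)) ≤ (x 2 : ℝ) ∧ (x 2 : ℝ) ≤ s₂ * (x 1 : ℝ))} := by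
  obtain ⟨-, hb2, hb3⟩ := hb
  rw [neg_one_mul] at h1 h2
  have h1r : (0 : ℝ) ≤ (b 2 : ℝ) - (x 2 : ℝ) := by
    have : 0 ≤ b 2 - x 2 := by linarith
    exact_mod_cast this
  have h2r : 4 * (m : ℝ) * ((b 2 : ℝ) - (x 2 : ℝ)) ≤ (x 1 : ℝ) - (b 1 : ℝ) := by
    have : 4 * (m : ℤ) * (b 2 - x 2) ≤ x 1 - b 1 := by linarith
    exact_mod_cast this
  have hm0 : (0 : ℝ) ≤ 4 * (m : ℝ) := by positivity
  have hd : (0 : ℝ) ≤ (x 1 : ℝ) - (b 1 : ℝ) := le_trans (mul_nonneg hm0 h1r) h2r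
  refine ⟨hx0, ?_, ?_⟩
  · have e1 : 1 * ((b 2 : ℝ) - (x 2 : ℝ)) ≤ (4 * (m : ℝ) * s₁) * ((b 2 : ℝ) - (x 2 : ℝ)) := mul_le_mul_of_nonneg_right hms₁ h1r
    have e2 : s₁ * (4 * (m : ℝ) * ((b 2 : ℝ) - (x 2 : ℝ))) ≤ s₁ * ((x 1 : ℝ) - (b 1 : ℝ)) :=
      mul_le_mul_of_nonneg_left h2r (by nlinarith)
    nlinarith
  · have : s₂ * (b 1 : ℝ) ≤ s₂ * (x 1 : ℝ) := mul_le_mul_of_nonneg_left (by linarith) hs₂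
    linarith

/-! ## §2 The design -/

/-- **The station's region**: `Ω = (0, m(4N+4), −(4N+4))`, `Z = 4N+4`, top `T = (m+1)(4N+4)` (`m ≥ 1`, `m s₁ ≥ 1`, `m s₂ ≥ 1`): inside `𝔹`
(`|x₂| ≤ Z ≤ min(s₁,s₂)·Y ≤ min(s₁,s₂)·x₁`), off the box, below `T`. [folklore] -/
theorem bsec_station_props (hs₁ : 0 < s₁) (hs₂ : 0 < s₂) (hm : 1 ≤ m) (hms₁ : 1 ≤ (m : ℝ) * s₁) (hms₂ : 1 ≤ (m : ℝ) * s₂) {x : Site 3}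
    (hx : x ∈ shallowReg k ![0, (m : ℤ) * (4 * (N : ℤ) + 4), -(4 * (N : ℤ) + 4)] (4 * (N : ℤ) + 4)) :
    x ∈ {x : Site 3 | x ∈ slab 3 k ∧ (-(s₁ * (x 1 : ℝ)) ≤ (x 2 : ℝ) ∧ (x 2 : ℝ) ≤ s₂ * (x 1 : ℝ))} ∧ x ∉ boxSet 3 N ∧
      x 1 ≤ (m : ℤ) * (4 * (N : ℤ) + 4) + (4 * (N : ℤ) + 4) := by
  obtain ⟨h0, h1, h2, h3, hZ⟩ := shallowReg_props hx
  simp only [Matrix.cons_val_one, Matrix.cons_val_zero, Matrix.cons_val] at h1 h2 h3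
  have hmZ : (1 : ℤ) * (4 * (N : ℤ) + 4) ≤ (m : ℤ) * (4 * (N : ℤ) + 4) :=
    mul_le_mul_of_nonneg_right (by exact_mod_cast hm) (by positivity)
  have h1r : (m : ℝ) * (4 * (N : ℝ) + 4) ≤ (x 1 : ℝ) := by exact_mod_cast h1
  have hZr : (x 2 : ℝ) ≤ 4 * (N : ℝ) + 4 := by exact_mod_cast hZ
  have h3r : -(4 * (N : ℝ) + 4) ≤ (x 2 : ℝ) := by exact_mod_cast h3
  have e1 : s₁ * ((m : ℝ) * (4 * (N : ℝ) + 4)) ≤ s₁ * (x 1 : ℝ) := mul_le_mul_of_nonneg_left h1r hs₁.le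
  have e2 : (1 : ℝ) * (4 * (N : ℝ) + 4) ≤ ((m : ℝ) * s₁) * (4 * (N : ℝ) + 4) := mul_le_mul_of_nonneg_right hms₁ (by positivity)
  have e3 : s₂ * ((m : ℝ) * (4 * (N : ℝ) + 4)) ≤ s₂ * (x 1 : ℝ) := mul_le_mul_of_nonneg_left h1r hs₂.le
  have e4 : (1 : ℝ) * (4 * (N : ℝ) + 4) ≤ ((m : ℝ) * s₂) * (4 * (N : ℝ) + 4) := mul_le_mul_of_nonneg_right hms₂ (by positivity)
  refine ⟨⟨h0, by nlinarith, by nlinarith⟩, not_mem_boxSet_of_lt (j := 1) (by rw [abs_of_nonneg (by omega)]; omega), by omega⟩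

/-- **The design at an inner-boundary vertex of the two-sided sector-slab** (`s₁, s₂ > 0`, `m ≥ 1`, `m s₁ ≥ 1`, `m s₂ ≥ 1`, `N ≥ k+1`; `α₄` an
arm bound of slope `1/(4m)` for both leanings and `A` a slab arm kit at `p'`): an increasing event, measurable, determined by the edges of `[-M,M]³`
(`M = k + (m+1)(4N+4)`), of `P_{p'} ≥ α₄·α`, on which `≤ k+1` extra open edges join `u` to the station `Ω = (0, m(4N+4), −(4N+4))` through open
exterior steps of `𝔹`. [cite: AizenmanChayesChayesFrohlichRusso1983, §4 Cor. to Lemma 4.3, Lemma 4.2 (a)] -/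
theorem bsec_vertex_design (hs₁ : 0 < s₁) (hs₂ : 0 < s₂) (hm : 1 ≤ m) (hms₁ : 1 ≤ (m : ℝ) * s₁) (hms₂ : 1 ≤ (m : ℝ) * s₂) (hN : k + 1 ≤ N)
    {p' : unitInterval} (A : SlabArmKit k p') {α₄ : ℝ} (hα₄ : 0 < α₄)
    (harm : ∀ σ : ℤ, (σ = 1 ∨ σ = -1) → ∀ b : Site 3, b ∈ slab 3 k →
      α₄ ≤ (bondPercolation (zdGraph 3) p').real (percolatesVia (withinGraph (zdGraph 3) (steepSetM (4 * m) k σ b)) b))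
    {u : Site 3} (hu : u ∈ boxSet 3 N)
    (hw : ∃ w, w ∉ boxSet 3 N ∧
      (withinGraph (zdGraph 3) {x : Site 3 | x ∈ slab 3 k ∧ (-(s₁ * (x 1 : ℝ)) ≤ (x 2 : ℝ) ∧ (x 2 : ℝ) ≤ s₂ * (x 1 : ℝ))}).Adj u w) :
    ∃ E : Set (BondConfig (Site 3)), IsUpperSet E ∧ MeasurableSet E ∧
      DeterminedBy E ↑(edgesIn (zdGraph 3) (box 3 (k + (m + 1) * (4 * N + 4)))) ∧
      α₄ * A.α ≤ (bondPercolation (zdGraph 3) p').real E ∧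
      ∀ ω ∈ E, ∃ F : Finset (Sym2 (Site 3)), F ⊆ edgesIn (zdGraph 3) (box 3 (k + (m + 1) * (4 * N + 4))) ∧ F.card ≤ k + 1 ∧
        ω ∪ ↑F ∈ openConnVia (starGraph (withinGraph (zdGraph 3)
          {x : Site 3 | x ∈ slab 3 k ∧ (-(s₁ * (x 1 : ℝ)) ≤ (x 2 : ℝ) ∧ (x 2 : ℝ) ≤ s₂ * (x 1 : ℝ))}) Set.univ (boxSet 3 N)) u
          ![0, (m : ℤ) * (4 * (N : ℤ) + 4), -(4 * (N : ℤ) + 4)] := by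
  obtain ⟨huP, hface⟩ := innerBdry_faces bsec_subset_slab hN hu hw
  obtain ⟨hu0, hu2, hu3⟩ := (mem_bsec_iff (k := k)).1 huP
  have hu1nn := nonneg_of_mem_bsec hs₁ hs₂ huP
  have hub := mem_boxSet_iff.1 hu
  have hu1 := hub 1; have hu2b := hub 2
  have hm1 : (1 : ℤ) ≤ (m : ℤ) := by exact_mod_cast hm
  have h4m0 : (0 : ℤ) < 4 * (m : ℤ) := by linarith
  have hms₁' : 1 ≤ 4 * (m : ℝ) * s₁ := by nlinarith
  have hms₂' : 1 ≤ 4 * (m : ℝ) * s₂ := by nlinarith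
  -- constants
  obtain ⟨Z, hZ⟩ : ∃ Z : ℤ, Z = 4 * (N : ℤ) + 4 := ⟨_, rfl⟩
  obtain ⟨Y, hY⟩ : ∃ Y : ℤ, Y = (m : ℤ) * (4 * (N : ℤ) + 4) := ⟨_, rfl⟩
  obtain ⟨T, hT⟩ : ∃ T : ℤ, T = Y + (4 * (N : ℤ) + 4) := ⟨_, rfl⟩
  have hYlo : 4 * (N : ℤ) + 4 ≤ Y := by
    have h := mul_le_mul_of_nonneg_right hm1 (show (0 : ℤ) ≤ 4 * (N : ℤ) + 4 by positivity)
    rw [hY]; linarith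
  have hTcast : ((k + (m + 1) * (4 * N + 4) : ℕ) : ℤ) = (k : ℤ) + T := by push_cast; rw [hT, hY]; ring
  have hTle : T ≤ 4 * (m : ℤ) * (2 * (N : ℤ) + 2) := by rw [hT, hY]; nlinarith
  set Ω : Site 3 := ![0, (m : ℤ) * (4 * (N : ℤ) + 4), -(4 * (N : ℤ) + 4)] with hΩ_def
  have hΩ0 : Ω 0 = 0 := by simp [hΩ_def]
  have hΩ1 : Ω 1 = Y := by simp [hΩ_def, hY]
  have hΩ2 : Ω 2 = -(4 * (N : ℤ) + 4) := by simp [hΩ_def]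
  have hΩslab : Ω ∈ slab 3 k := by show 0 ≤ Ω 0 ∧ Ω 0 ≤ (k : ℤ); rw [hΩ0]; exact ⟨le_rfl, by positivity⟩
  have hH : ∀ x ∈ shallowReg k Ω (4 * (N : ℤ) + 4),
      x ∈ {x : Site 3 | x ∈ slab 3 k ∧ (-(s₁ * (x 1 : ℝ)) ≤ (x 2 : ℝ) ∧ (x 2 : ℝ) ≤ s₂ * (x 1 : ℝ))} ∧ x ∉ boxSet 3 N ∧ x 1 ≤ T :=
    fun x hx => by rw [hT, hY]; exact bsec_station_props hs₁ hs₂ hm hms₁ hms₂ hx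
  have hwinH : ∀ x ∈ shallowReg k Ω (4 * (N : ℤ) + 4), ∀ j, |x j| ≤ (k + (m + 1) * (4 * N + 4) : ℕ) := by
    intro x hx j
    rw [hTcast]
    obtain ⟨h0, h1, h2, h3, hZ'⟩ := shallowReg_props hx
    rw [hΩ1] at h1 h2; rw [hΩ2] at h2 h3
    fin_cases j <;> rw [abs_le] <;> constructor <;> simp <;> linarith
  -- generic packaging: apex `b ∈ 𝔹` adjacent to `u`, off the box, `b₁ ≤ N+1`, `|b₂| ≤ N+1`; arm `steepSetM (4m) k σ b` off the box
  have pack : ∀ {σ : ℤ} (_ : σ = 1 ∨ σ = -1) {b : Site 3}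
      (_ : b ∈ {x : Site 3 | x ∈ slab 3 k ∧ (-(s₁ * (x 1 : ℝ)) ≤ (x 2 : ℝ) ∧ (x 2 : ℝ) ≤ s₂ * (x 1 : ℝ))}) (_ : b 1 ≤ (N : ℤ) + 1)
      (_ : |b 2| ≤ (N : ℤ) + 1) (_ : (zdGraph 3).Adj u b) (_ : b ∉ boxSet 3 N)
      (_ : ∀ x ∈ steepSetM (4 * m) k σ b ∩ {x | x 1 ≤ T}, x ∉ boxSet 3 N),
      ∃ E : Set (BondConfig (Site 3)), IsUpperSet E ∧ MeasurableSet E ∧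
        DeterminedBy E ↑(edgesIn (zdGraph 3) (box 3 (k + (m + 1) * (4 * N + 4)))) ∧
        α₄ * A.α ≤ (bondPercolation (zdGraph 3) p').real E ∧
        ∀ ω ∈ E, ∃ F : Finset (Sym2 (Site 3)), F ⊆ edgesIn (zdGraph 3) (box 3 (k + (m + 1) * (4 * N + 4))) ∧ F.card ≤ k + 1 ∧
          ω ∪ ↑F ∈ openConnVia (starGraph (withinGraph (zdGraph 3)
            {x : Site 3 | x ∈ slab 3 k ∧ (-(s₁ * (x 1 : ℝ)) ≤ (x 2 : ℝ) ∧ (x 2 : ℝ) ≤ s₂ * (x 1 : ℝ))}) Set.univ (boxSet 3 N)) u Ω := by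
    intro σ hσ b hbP hb1hi hb2 hadj hbbox hSbox
    have hb2' := abs_le.1 hb2
    have hbslab : b ∈ slab 3 k := hbP.1
    have hb1nn := nonneg_of_mem_bsec hs₁ hs₂ hbP
    set S : Set (Site 3) := steepSetM (4 * m) k σ b ∩ {x | x 1 ≤ T} with hS_def
    have hbS : b ∈ S := ⟨self_mem_steepSetM hbslab, by show b 1 ≤ T; linarith⟩
    have hSprops : ∀ x ∈ S, (0 ≤ x 0 ∧ x 0 ≤ (k : ℤ)) ∧ b 1 ≤ x 1 ∧ x 1 ≤ T ∧ 0 ≤ σ * (x 2 - b 2) ∧ σ * (x 2 - b 2) ≤ 2 * (N : ℤ) + 2 ∧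
        x ∈ {x : Site 3 | x ∈ slab 3 k ∧ (-(s₁ * (x 1 : ℝ)) ≤ (x 2 : ℝ) ∧ (x 2 : ℝ) ≤ s₂ * (x 1 : ℝ))} := by
      rintro x ⟨⟨h0, h1, h2⟩, hxT⟩
      have hxT' : x 1 ≤ T := hxT
      push_cast at h2
      have hA : (0 : ℤ) ≤ 4 * (m : ℤ) * (σ * (x 2 - b 2)) := mul_nonneg h4m0.le h1
      have hsp : σ * (x 2 - b 2) ≤ 2 * (N : ℤ) + 2 := by
        refine le_of_mul_le_mul_left ?_ h4m0
        calc 4 * (m : ℤ) * (σ * (x 2 - b 2)) ≤ x 1 - b 1 := h2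
          _ ≤ T := by linarith
          _ ≤ 4 * (m : ℤ) * (2 * (N : ℤ) + 2) := hTle
      have hxD : x ∈ {x : Site 3 | x ∈ slab 3 k ∧ (-(s₁ * (x 1 : ℝ)) ≤ (x 2 : ℝ) ∧ (x 2 : ℝ) ≤ s₂ * (x 1 : ℝ))} := by
        rcases hσ with rfl | rfl
        · rw [one_mul] at h1 h2; exact mem_bsec_of_armPos hs₁.le hms₂' hbP h0 h1 h2
        · exact mem_bsec_of_armNeg hs₂.le hms₁' hbP h0 h1 h2
      exact ⟨h0, by linarith, hxT', h1, hsp, hxD⟩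
    have hSz : ∀ x ∈ S, Ω 2 ≤ x 2 ∧ x 2 ≤ 4 * (N : ℤ) + 4 := fun x hx => by
      obtain ⟨-, -, -, h3, h4, -⟩ := hSprops x hx
      rw [hΩ2]
      rcases hσ with rfl | rfl
      · rw [one_mul] at h3 h4; constructor <;> linarith
      · rw [neg_one_mul] at h3 h4; constructor <;> linarith
    have hSD : ∀ x ∈ S, x ∈ {x : Site 3 | x ∈ slab 3 k ∧ (-(s₁ * (x 1 : ℝ)) ≤ (x 2 : ℝ) ∧ (x 2 : ℝ) ≤ s₂ * (x 1 : ℝ))} ∧ x ∉ boxSet 3 N :=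
      fun x hx => ⟨(hSprops x hx).2.2.2.2.2, hSbox x hx⟩
    have hM : ∀ x ∈ S ∪ shallowReg k Ω (4 * (N : ℤ) + 4), ∀ j, |x j| ≤ (k + (m + 1) * (4 * N + 4) : ℕ) := by
      rintro x (hx | hx) j
      · rw [hTcast]
        obtain ⟨h0, h1, h2, -, -, -⟩ := hSprops x hx
        obtain ⟨h3, h4⟩ := hSz x hx
        rw [hΩ2] at h3
        fin_cases j <;> rw [abs_le] <;> constructor <;> simp <;> linarith
      · exact hwinH x hx j
    set E : Set (BondConfig (Site 3)) := reachEvent (withinGraph (zdGraph 3) S) b {x | x 1 = T} ∩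
      reachEvent (withinGraph (zdGraph 3) (shallowReg k Ω (4 * (N : ℤ) + 4))) Ω {x | x 2 = 4 * (N : ℤ) + 4} with hE
    have hSfin : S.Finite := (boxSet_finite _).subset (subset_boxSet_of_abs_le fun x hx => hM x (Or.inl hx))
    have hprobS : α₄ ≤ (bondPercolation (zdGraph 3) p').real (reachEvent (withinGraph (zdGraph 3) S) b {x | x 1 = T}) :=
      le_real_of_subset (percolatesVia_subset_reachEvent_le (self_mem_steepSetM hbslab) 1 (by linarith)
        (by simpa [hS_def] using hSfin)) (harm σ hσ b hbslab)
    have hprobH : A.α ≤ (bondPercolation (zdGraph 3) p').real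
        (reachEvent (withinGraph (zdGraph 3) (shallowReg k Ω (4 * (N : ℤ) + 4))) Ω {x | x 2 = 4 * (N : ℤ) + 4}) :=
      le_real_of_subset (percolatesVia_subset_reachEvent_le (self_mem_shallowSet hΩslab) 2 (by rw [hΩ2]; linarith)
        (by simpa only [HalfSlabUniq.shallowReg] using shallowReg_finite (k := k) Ω (4 * (N : ℤ) + 4))) (A.shallow_arm Ω hΩslab)
    refine ⟨E, (isUpperSet_reachEvent _ _ _).inter (isUpperSet_reachEvent _ _ _),
      (measurableSet_reachEvent _ _ _).inter (measurableSet_reachEvent _ _ _), ?_, ?_, fun ω hω => ?_⟩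
    · exact ((determinedBy_reachEvent _ _ _).mono (edgeSet_withinGraph_subset_edgesIn (subset_boxSet_of_abs_le fun x hx =>
        hM x (Or.inl hx)))).inter ((determinedBy_reachEvent _ _ _).mono (edgeSet_withinGraph_subset_edgesIn
          (subset_boxSet_of_abs_le fun x hx => hM x (Or.inr hx))))
    · exact harris2_of_le p' (isUpperSet_reachEvent _ _ _) (isUpperSet_reachEvent _ _ _) (measurableSet_reachEvent _ _ _)
        (measurableSet_reachEvent _ _ _) hα₄.le hprobS hprobH
    · obtain ⟨F, hFs, hFc, hFr⟩ := move_apex_cyl_region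
        (D := {x : Site 3 | x ∈ slab 3 k ∧ (-(s₁ * (x 1 : ℝ)) ≤ (x 2 : ℝ) ∧ (x 2 : ℝ) ≤ s₂ * (x 1 : ℝ))}) (by omega)
        bsec_cyl (S := S) (fun x hx => (hSprops x hx).1) hbS hΩslab (by rw [hΩ2]; linarith) (by rw [hΩ1]; linarith)
        (fun x hx => ⟨(hSD x hx).1, (hSD x hx).2, ⟨(hSprops x hx).2.1, (hSprops x hx).2.2.1⟩, hSz x hx⟩) hH hM hω
      have hMN : N ≤ k + (m + 1) * (4 * N + 4) := by nlinarith
      have hwu : ∀ j, |u j| ≤ (k + (m + 1) * (4 * N + 4) : ℕ) := abs_le_of_mem_boxSet hu hMN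
      have hwb : ∀ j, |b j| ≤ (k + (m + 1) * (4 * N + 4) : ℕ) := hM b (Or.inl hbS)
      refine ⟨insert s(u, b) F, ?_, (Finset.card_insert_le _ _).trans (by omega), ?_⟩
      · intro e he
        rcases Finset.mem_insert.1 he with rfl | he
        · exact mem_edgesIn_of_adj hadj hwu hwb
        · exact hFs he
      · exact openConnVia_step (dext_adj_of hadj huP hbP fun h' => hbbox h'.2) (Finset.mem_insert_self _ _)
          (openConnVia_mono_finset (Finset.subset_insert _ _) hFr)
  rcases hface with ⟨htop, hbD⟩ | ⟨hright, hbD⟩ | ⟨hleft, hbD⟩ | ⟨hbot, -⟩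
  · -- TOP face: escape `u → b = u + e₁ ∈ 𝔹`; lean towards the axis: `+e₂` if `u₂ ≤ 0`, `−e₂` if `u₂ > 0`
    set b : Site 3 := u + Pi.single 1 1 with hb_def
    have hb1 : b 1 = (N : ℤ) + 1 := by simp [hb_def, htop]
    have hb2 : b 2 = u 2 := by simp [hb_def]
    have hadj : (zdGraph 3).Adj u b := (zdGraph_adj_iff _ _).2 ⟨1, Or.inl rfl⟩
    have hbbox : b ∉ boxSet 3 N := not_mem_boxSet_of_lt (j := 1) (by rw [hb1, abs_of_nonneg (by omega)]; omega)
    by_cases hu2s : u 2 ≤ 0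
    · refine pack (Or.inl rfl) hbD (by rw [hb1]) (by rw [hb2, abs_le]; constructor <;> omega) hadj hbbox fun x hx => ?_
      obtain ⟨⟨-, h1, h2⟩, -⟩ := hx
      rw [one_mul, hb2] at h1; rw [one_mul, hb2, hb1] at h2
      push_cast at h2
      have : (0 : ℤ) ≤ 4 * (m : ℤ) * (x 2 - u 2) := mul_nonneg h4m0.le h1
      exact not_mem_boxSet_of_lt (j := 1) (by rw [abs_of_nonneg (by linarith)]; linarith)
    · refine pack (Or.inr rfl) hbD (by rw [hb1]) (by rw [hb2, abs_le]; constructor <;> omega) hadj hbbox fun x hx => ?_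
      obtain ⟨⟨-, h1, h2⟩, -⟩ := hx
      rw [neg_one_mul, hb2] at h1; rw [neg_one_mul, hb2, hb1] at h2
      push_cast at h2
      have : (0 : ℤ) ≤ 4 * (m : ℤ) * (-(x 2 - u 2)) := mul_nonneg h4m0.le h1
      exact not_mem_boxSet_of_lt (j := 1) (by rw [abs_of_nonneg (by linarith)]; linarith)
  · -- RIGHT face: escape `u → b = u + e₂ ∈ 𝔹`, lean `+e₂`
    set b : Site 3 := u + Pi.single 2 1 with hb_def
    have hb1 : b 1 = u 1 := by simp [hb_def]
    have hb2 : b 2 = (N : ℤ) + 1 := by simp [hb_def, hright]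
    refine pack (Or.inl rfl) hbD (by rw [hb1]; omega) (by rw [hb2, abs_of_nonneg (by positivity)]) ((zdGraph_adj_iff _ _).2 ⟨2, Or.inl rfl⟩)
      (not_mem_boxSet_of_lt (j := 2) (by rw [hb2, abs_of_nonneg (by omega)]; omega)) fun x hx => ?_
    obtain ⟨⟨-, h1, -⟩, -⟩ := hx
    rw [one_mul, hb2] at h1
    exact not_mem_boxSet_of_lt (j := 2) (by rw [abs_of_nonneg (by linarith)]; linarith)
  · -- LEFT face: escape `u → b = u − e₂ ∈ 𝔹`, lean `−e₂`
    set b : Site 3 := u - Pi.single 2 1 with hb_def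
    have hb1 : b 1 = u 1 := by simp [hb_def]
    have hb2 : b 2 = -(N : ℤ) - 1 := by simp [hb_def, hleft]
    refine pack (Or.inr rfl) hbD (by rw [hb1]; omega) (by rw [hb2, abs_le]; constructor <;> omega)
      ((zdGraph_adj_iff _ _).2 ⟨2, Or.inr (by rw [hb_def, sub_add_cancel])⟩)
      (not_mem_boxSet_of_lt (j := 2) (by rw [hb2, abs_of_nonpos (by omega)]; omega)) fun x hx => ?_
    obtain ⟨⟨-, h1, -⟩, -⟩ := hx
    rw [neg_one_mul, hb2] at h1
    exact not_mem_boxSet_of_lt (j := 2) (by rw [abs_of_nonpos (by linarith)]; linarith)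
  · -- BOTTOM face: impossible (`x₁ ≥ 0` in `𝔹`, `N ≥ 1`)
    exfalso; rw [hbot] at hu1nn; omega

end BiSectorSlab

end Summit.CriticalPhenomena.PercolationContinuityZ3.Theorems.Transplant

end
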